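import Summits.Ventures.PercRepro.GenQSevenFiveColoopFree
import Summits.Ventures.PercRepro.GenQOpenLayersCoreFree
import Summits.Ventures.PercRepro.GenQOpenLayersCoreSmall

/-!
# PercRepro — the `(7, 5)` trace sums are the level-`5` trace sums of the general reduction (night-4, gen 2)

`TraceSumsCore 4` (`GenQOpenLayersCoreFree.lean`) asks the trace sums of level `5` at every type `t ≤ 4` on the rank-`4`
subsets of rank-`7` Core matroids; `SevenFiveTraceSumsCore` (`GenQSevenFiveColoopFree.lean`) asks them at `t = 2, 3, 4`
only.  The types `t = 0, 1` are free: a rank-`4` set `H` of a rank-`7` matroid misses some point `a ∉ cl H`, the trace sum is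
the balance of `H ∪ {a}` (`Jq_hyp_add_one_eq`), and the balances at `t = 0` and `t = 1` (level `5`) are the landed
`Jq_zero_nonneg` and `Jq_one_nonneg_of_le_five`.  So `traceSumsCore_four_of_sevenFive : SevenFiveTraceSumsCore →
TraceSumsCore 4`, and the `(7, 5)` row is the `q = 5` instance of `rls_succ_succ_of_free` (`rls_seven_five_of_free'`).
The two spellings of the coloop-free `(7, 5)` layers agree: `sevenFiveLayersCoreFree_iff_openLayersCoreFree_five`
(the type-`1` clause is vacuous at `q = 5`, the type-`2` window is `g ≤ 10`, and `𝔉` is automatic on the core).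
-/

namespace PercRepro.GenQ

open Finset ThmH PerFlat SixFour ThmN NightThree

/-- A set of rank below the rank of `M` misses a point of the ground set outside its closure. -/
theorem exists_notMem_closure_of_eRk_lt {γ : Type} [DecidableEq γ] {M : Matroid γ} [M.Finite] {H : Finset γ}
    (hlt : M.eRk (H : Set γ) < M.eRank) : ∃ a ∈ gr M, a ∉ M.closure (H : Set γ) := by
  by_contra hcon
  push Not at hcon
  have hsub : M.E ⊆ M.closure (H : Set γ) := by
    intro x hx
    have hx' : x ∈ gr M := by
      rw [← Finset.mem_coe, coe_gr]
      exact hx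
    exact hcon x hx'
  have h1 : M.eRank ≤ M.eRk (M.closure (H : Set γ)) := by
    rw [Matroid.eRank_def]
    exact M.eRk_mono hsub
  rw [M.eRk_closure_eq] at h1
  exact absurd hlt (not_lt.2 h1)

/-- **`SevenFiveTraceSumsCore` gives the full `TraceSumsCore 4`**: the types `0` and `1` are the landed balances of
`H ∪ {a}`. -/
theorem traceSumsCore_four_of_sevenFive (h : SevenFiveTraceSumsCore) : TraceSumsCore 4 := by
  intro β _ M _ H hc hH hr t ht
  by_cases ht2 : 2 ≤ t
  · exact h M H hc hH hr t ht2 ht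
  · -- `t = 0` or `t = 1`: the balance of `H ∪ {a}` for a point `a ∉ cl H`
    have hlt : M.eRk (H : Set β) < M.eRank := by
      rw [hr, hc.2.1]
      exact_mod_cast (by norm_num : (4 : ℕ) < 4 + 1 + 2)
    obtain ⟨a, ha, hacl⟩ := exists_notMem_closure_of_eRk_lt hlt
    have haH : a ∉ H := fun hmem => hacl (M.subset_closure (H : Set β) (by
      rw [← coe_gr M]
      exact_mod_cast hH) (Finset.mem_coe.2 hmem))
    have key := Jq_hyp_add_one_eq (M := M) (τ := H) (q := 4) ha haH hacl hr t
    rw [← key]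
    have hG : insert a H ⊆ gr M := Finset.insert_subset ha hH
    rcases (show t = 0 ∨ t = 1 by omega) with rfl | rfl
    · exact Jq_zero_nonneg hG (4 + 1)
    · have haE : a ∈ M.E := by
        rw [← coe_gr M]
        exact_mod_cast ha
      have hr' : M.eRk ((insert a H : Finset β) : Set β) = ((4 + 1 : ℕ) : ℕ∞) := by
        rw [Finset.coe_insert, Matroid.eRk_insert_eq_add_one ⟨haE, hacl⟩, hr]
        rfl
      exact Jq_one_nonneg_of_le_five (simple_of_core hc) hG hr' (by norm_num) (by norm_num)

/-- **`(7, 5)` as the `q = 5` instance of the general coloop reduction.** -/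
theorem rls_seven_five_of_free' {α : Type} [DecidableEq α] (htr : SevenFiveTraceSumsCore)
    (hfree : OpenLayersCoreFree 5) (M : Matroid α) [M.Finite] : RLS M 7 5 := by
  refine rls_succ_succ_of_free 5 (by norm_num) ?_ ?_ M
  · intro q' h4 h5
    obtain rfl : q' = 4 := by omega
    exact traceSumsCore_four_of_sevenFive htr
  · intro q' h5 h5'
    obtain rfl : q' = 5 := by omega
    exact hfree

/-- **The two spellings of the coloop-free `(7, 5)` layers agree.** -/
theorem sevenFiveLayersCoreFree_iff_openLayersCoreFree_five : SevenFiveLayersCoreFree ↔ OpenLayersCoreFree 5 := by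
  constructor
  · intro h β _ M _ G hc hG _ hm
    obtain ⟨h2, h3, h4⟩ := h M G hc hG hm
    refine ⟨fun h6 => absurd h6 (by norm_num), ?_, ?_⟩
    · intro hwin
      apply h2
      by_contra hg
      push Not at hg
      have h6 : 6 ≤ G.card - 5 := by omega
      have h9 : 9 ≤ G.card - 5 + 3 := by omega
      have := Nat.mul_le_mul h6 h9
      omega
    · intro t ht3 ht
      have : t = 3 ∨ t = 4 := by omega
      rcases this with rfl | rfl
      · exact h3
      · exact h4
  · intro h β _ M _ G hc hG hm
    obtain ⟨_, h2, h3⟩ := h M G hc hG (twoHyp_of_core hc (by norm_num) hG) hm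
    refine ⟨fun hg => h2 ?_, h3 3 (by norm_num) (by norm_num), h3 4 (by norm_num) (by norm_num)⟩
    have h5 : G.card - 5 ≤ 5 := by omega
    have h8 : G.card - 5 + 3 ≤ 8 := by omega
    have := Nat.mul_le_mul h5 h8
    omega

end PercRepro.GenQ
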